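import Summits.QuantumFields.QCD.Theses.PauliWegnerSea
import Literature.MathematicalPhysics.QuantumFieldTheory.StrongCouplingActivities
import Literature.MathematicalPhysics.QuantumFieldTheory.QCDPhaseQuenched
import Literature.MathematicalPhysics.QuantumLattice.WilsonDiracAP

/-!
# Crux `TiltedFlatness` (stmt-QuantumFields-14070), line `circle-transport` — stub `stub_bandLimit`

**What is proved.** `stub_bandLimit`: moving ONE link of an `SU(3)` lattice gauge field along
the circle `s ↦ A · T(s) · B`, `T(s) = diag(e^{is}, e^{-is}, 1)`, the squared modulus
`s ↦ |det D(U_s)|²` of the `N_f`-flavour Wilson fermion determinant is a trigonometric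
polynomial `∑_{|k| ≤ 48 N_f} a_k e^{iks}`; the degree bound is free of the volume `L`, the
background `U`, the masses and `A, B`.

**Proof.** A function `F : ℝ → ℂ` is handled as a "trigonometric polynomial of degree `≤ n`"
in the Laurent form `F(s) = e^{-ins} P(e^{is})`, `P ∈ ℂ[X]`, `deg P ≤ 2n` (written inline: the
file is definition-free). This class contains the constants and `e^{± is}`, is closed under
sums, `if`, scalar multiples, is monotone in `n`, and degrees add under products (`P · Q`).
Determinant lemma `tp_det`: if the entries of row `i` of `M(s)` have degree `≤ d i` then
`det M(s)` has degree `≤ ∑ i, d i` — the matrix of polynomials `P` has `deg det P ≤ ∑ 2 d i`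
by the Leibniz expansion (as in Mathlib's `Polynomial.natDegree_det_X_add_C_le`), and
`(det P)(e^{is}) = det (diag(e^{i d_i s}) · M(s)) = e^{i (∑ d_i) s} det M(s)` (`RingHom.map_det`).
The entries of `A T(s) B` and of `(A T(s) B)⁻¹ = B⁻¹ T(s)⁻¹ A⁻¹` have degree `≤ 1`
(`tp_link`, `tp_link_inv`); in the one-flavour Wilson–Dirac matrix `D_W(U_s)` (tree
`wilsonDirac`: forward hop through `U(x, μ)` in row `x`, backward hop through `U(y, μ)⁻¹` in
row `y + μ̂`) only the rows through the two endpoints of the moved link depend on `s`, with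
degree `≤ 1` (`tp_entry`); there are at most `2 · 3 · 4 = 24` of them, so `det D_W(U_s)` has
degree `≤ 24` (`tp_fermionDet`). The flavour product (`det_diracMatrix`) has degree `≤ 24 N_f`,
the Wilson determinant is real (`det_diracMatrix_im`), so `|det|² = det · det` has degree
`≤ 48 N_f`; finally `e^{-ins} P(e^{is}) = ∑_{|k| ≤ n} P_{k+n} e^{iks}` (`tp_fourier`).

Sources: Montvay–Münster, *Quantum Fields on a Lattice*, §4.2 (4.85) and §5.1 (Wilson–Dirac
matrix, flavour-diagonal determinant); the degree count along one link is folklore.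
-/

noncomputable section

namespace Summit.QuantumFields.QCD.Theorems.CircleTransport

open scoped BigOperators Real Matrix.Norms.L2Operator
open MeasureTheory Set Filter
open Literature.MathematicalPhysics.QuantumFieldTheory Literature.MathematicalPhysics.QuantumLattice
  Literature.Probability.LatticeModels

/-- `SU(3)` (the tree's `Matrix.specialUnitaryGroup (Fin 3) ℂ`). -/
local notation "SU3" => Matrix.specialUnitaryGroup (Fin 3) ℂ

/-! ### Trigonometric polynomials in Laurent form `F(s) = e^{-ins} P(e^{is})`, `deg P ≤ 2n` -/

section TrigPoly

open Polynomial Complex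

/-- Constants have every degree `n` (`P = c X^n`). -/
private theorem tp_const (n : ℕ) (c : ℂ) : ∃ P : ℂ[X], P.natDegree ≤ 2 * n ∧ ∀ s : ℝ,
    c = exp (-((n : ℂ) * s * I)) * P.eval (exp (s * I)) := by
  refine ⟨Polynomial.C c * X ^ n,
    (natDegree_C_mul_le _ _).trans ((natDegree_X_pow_le n).trans (by omega)), fun s => ?_⟩
  rw [eval_mul, eval_C, eval_pow, eval_X, ← Complex.exp_nat_mul, mul_left_comm, ← Complex.exp_add,
    show -((n : ℂ) * s * I) + n * (s * I) = 0 by ring, Complex.exp_zero, mul_one]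

/-- `e^{is}` has degree `1` (`P = X²`). -/
private theorem tp_exp : ∃ P : ℂ[X], P.natDegree ≤ 2 * 1 ∧ ∀ s : ℝ,
    exp (s * I) = exp (-(((1 : ℕ) : ℂ) * s * I)) * P.eval (exp (s * I)) := by
  refine ⟨X ^ 2, natDegree_X_pow_le 2, fun s => ?_⟩
  rw [eval_pow, eval_X, ← Complex.exp_nat_mul, ← Complex.exp_add]
  congr 1; push_cast; ring

/-- `e^{-is}` has degree `1` (`P = 1`). -/
private theorem tp_exp_neg : ∃ P : ℂ[X], P.natDegree ≤ 2 * 1 ∧ ∀ s : ℝ,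
    exp (-(s * I)) = exp (-(((1 : ℕ) : ℂ) * s * I)) * P.eval (exp (s * I)) := by
  refine ⟨1, by simp, fun s => ?_⟩
  rw [eval_one, mul_one]
  congr 1; push_cast; ring

/-- Monotonicity in the degree (`P ↦ P X^{m-n}`). -/
private theorem tp_mono {n m : ℕ} (h : n ≤ m) {F : ℝ → ℂ}
    (hF : ∃ P : ℂ[X], P.natDegree ≤ 2 * n ∧ ∀ s : ℝ,
      F s = exp (-((n : ℂ) * s * I)) * P.eval (exp (s * I))) :
    ∃ P : ℂ[X], P.natDegree ≤ 2 * m ∧ ∀ s : ℝ,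
      F s = exp (-((m : ℂ) * s * I)) * P.eval (exp (s * I)) := by
  obtain ⟨P, hP, hF⟩ := hF
  refine ⟨P * X ^ (m - n),
    natDegree_mul_le.trans ((add_le_add hP (natDegree_X_pow_le _)).trans (by omega)),
    fun s => ?_⟩
  rw [hF s, eval_mul, eval_pow, eval_X, ← Complex.exp_nat_mul, Nat.cast_sub h,
    mul_comm (P.eval _) _, ← mul_assoc, ← Complex.exp_add]
  congr 2; ring

/-- Closure under sums. -/
private theorem tp_add {n : ℕ} {F G : ℝ → ℂ}
    (hF : ∃ P : ℂ[X], P.natDegree ≤ 2 * n ∧ ∀ s : ℝ,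
      F s = exp (-((n : ℂ) * s * I)) * P.eval (exp (s * I)))
    (hG : ∃ P : ℂ[X], P.natDegree ≤ 2 * n ∧ ∀ s : ℝ,
      G s = exp (-((n : ℂ) * s * I)) * P.eval (exp (s * I))) :
    ∃ P : ℂ[X], P.natDegree ≤ 2 * n ∧ ∀ s : ℝ,
      F s + G s = exp (-((n : ℂ) * s * I)) * P.eval (exp (s * I)) := by
  obtain ⟨P, hP, hF⟩ := hF
  obtain ⟨Q, hQ, hG⟩ := hG
  exact ⟨P + Q, (natDegree_add_le _ _).trans (max_le hP hQ), fun s => by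
    rw [hF s, hG s, eval_add, mul_add]⟩

/-- Closure under differences. -/
private theorem tp_sub {n : ℕ} {F G : ℝ → ℂ}
    (hF : ∃ P : ℂ[X], P.natDegree ≤ 2 * n ∧ ∀ s : ℝ,
      F s = exp (-((n : ℂ) * s * I)) * P.eval (exp (s * I)))
    (hG : ∃ P : ℂ[X], P.natDegree ≤ 2 * n ∧ ∀ s : ℝ,
      G s = exp (-((n : ℂ) * s * I)) * P.eval (exp (s * I))) :
    ∃ P : ℂ[X], P.natDegree ≤ 2 * n ∧ ∀ s : ℝ,
      F s - G s = exp (-((n : ℂ) * s * I)) * P.eval (exp (s * I)) := by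
  obtain ⟨P, hP, hF⟩ := hF
  obtain ⟨Q, hQ, hG⟩ := hG
  exact ⟨P - Q, (natDegree_sub_le _ _).trans (max_le hP hQ), fun s => by
    rw [hF s, hG s, eval_sub, mul_sub]⟩

/-- Closure under left scalar multiplication. -/
private theorem tp_smul {n : ℕ} (c : ℂ) {F : ℝ → ℂ}
    (hF : ∃ P : ℂ[X], P.natDegree ≤ 2 * n ∧ ∀ s : ℝ,
      F s = exp (-((n : ℂ) * s * I)) * P.eval (exp (s * I))) :
    ∃ P : ℂ[X], P.natDegree ≤ 2 * n ∧ ∀ s : ℝ,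
      c * F s = exp (-((n : ℂ) * s * I)) * P.eval (exp (s * I)) := by
  obtain ⟨P, hP, hF⟩ := hF
  exact ⟨Polynomial.C c * P, (natDegree_C_mul_le _ _).trans hP, fun s => by
    rw [hF s, eval_mul, eval_C]; ring⟩

/-- Closure under right scalar multiplication. -/
private theorem tp_mul_const {n : ℕ} (c : ℂ) {F : ℝ → ℂ}
    (hF : ∃ P : ℂ[X], P.natDegree ≤ 2 * n ∧ ∀ s : ℝ,
      F s = exp (-((n : ℂ) * s * I)) * P.eval (exp (s * I))) :
    ∃ P : ℂ[X], P.natDegree ≤ 2 * n ∧ ∀ s : ℝ,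
      F s * c = exp (-((n : ℂ) * s * I)) * P.eval (exp (s * I)) := by
  obtain ⟨P, hP, hF⟩ := hF
  exact ⟨P * Polynomial.C c, (natDegree_mul_C_le _ _).trans hP, fun s => by
    rw [hF s, eval_mul, eval_C]; ring⟩

/-- Closure under `if`. -/
private theorem tp_ite {n : ℕ} {c : Prop} [Decidable c] {F G : ℝ → ℂ}
    (hF : c → ∃ P : ℂ[X], P.natDegree ≤ 2 * n ∧ ∀ s : ℝ,
      F s = exp (-((n : ℂ) * s * I)) * P.eval (exp (s * I)))
    (hG : ¬c → ∃ P : ℂ[X], P.natDegree ≤ 2 * n ∧ ∀ s : ℝ,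
      G s = exp (-((n : ℂ) * s * I)) * P.eval (exp (s * I))) :
    ∃ P : ℂ[X], P.natDegree ≤ 2 * n ∧ ∀ s : ℝ,
      (if c then F s else G s) = exp (-((n : ℂ) * s * I)) * P.eval (exp (s * I)) := by
  by_cases hc : c
  · simp only [if_pos hc]; exact hF hc
  · simp only [if_neg hc]; exact hG hc

/-- Closure under finite sums. -/
private theorem tp_sum {α : Type*} {n : ℕ} (S : Finset α) {F : α → ℝ → ℂ}
    (hF : ∀ i ∈ S, ∃ P : ℂ[X], P.natDegree ≤ 2 * n ∧ ∀ s : ℝ,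
      F i s = exp (-((n : ℂ) * s * I)) * P.eval (exp (s * I))) :
    ∃ P : ℂ[X], P.natDegree ≤ 2 * n ∧ ∀ s : ℝ,
      ∑ i ∈ S, F i s = exp (-((n : ℂ) * s * I)) * P.eval (exp (s * I)) := by
  classical
  induction S using Finset.induction_on with
  | empty => exact ⟨0, by simp, fun s => by simp⟩
  | insert a S ha ih =>
    obtain ⟨P, hP, hFa⟩ := hF a (Finset.mem_insert_self a S)
    obtain ⟨Q, hQ, hG⟩ := ih fun i hi => hF i (Finset.mem_insert_of_mem hi)
    exact ⟨P + Q, (natDegree_add_le _ _).trans (max_le hP hQ), fun s => by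
      rw [Finset.sum_insert ha, hFa s, hG s, eval_add, mul_add]⟩

/-- Degrees add under products (`P · Q`). -/
private theorem tp_mul {a b : ℕ} {F G : ℝ → ℂ}
    (hF : ∃ P : ℂ[X], P.natDegree ≤ 2 * a ∧ ∀ s : ℝ,
      F s = exp (-((a : ℂ) * s * I)) * P.eval (exp (s * I)))
    (hG : ∃ P : ℂ[X], P.natDegree ≤ 2 * b ∧ ∀ s : ℝ,
      G s = exp (-((b : ℂ) * s * I)) * P.eval (exp (s * I))) :
    ∃ P : ℂ[X], P.natDegree ≤ 2 * (a + b) ∧ ∀ s : ℝ,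
      F s * G s = exp (-(((a + b : ℕ) : ℂ) * s * I)) * P.eval (exp (s * I)) := by
  obtain ⟨P, hP, hF⟩ := hF
  obtain ⟨Q, hQ, hG⟩ := hG
  refine ⟨P * Q, natDegree_mul_le.trans (by omega), fun s => ?_⟩
  rw [hF s, hG s, eval_mul, Nat.cast_add,
    show -((a + b : ℂ) * s * I) = -(a * s * I) + -(b * s * I) by ring, Complex.exp_add]
  ring

/-- Finite products over a `Fintype`: degree `card · n` (`∏ P_i`). -/
private theorem tp_prod {α : Type*} [Fintype α] {n : ℕ} {F : α → ℝ → ℂ}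
    (hF : ∀ i, ∃ P : ℂ[X], P.natDegree ≤ 2 * n ∧ ∀ s : ℝ,
      F i s = exp (-((n : ℂ) * s * I)) * P.eval (exp (s * I))) :
    ∃ P : ℂ[X], P.natDegree ≤ 2 * (Fintype.card α * n) ∧ ∀ s : ℝ,
      ∏ i, F i s = exp (-(((Fintype.card α * n : ℕ) : ℂ) * s * I)) * P.eval (exp (s * I)) := by
  choose P hP hF using hF
  refine ⟨∏ i, P i, (natDegree_prod_le _ _).trans ?_, fun s => ?_⟩
  · calc ∑ i, (P i).natDegree ≤ ∑ _i : α, 2 * n := Finset.sum_le_sum fun i _ => hP i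
      _ = 2 * (Fintype.card α * n) := by
        rw [Finset.sum_const, smul_eq_mul, Finset.card_univ]; ring
  · rw [eval_prod, Finset.prod_congr rfl fun i _ => hF i s, Finset.prod_mul_distrib,
      Finset.prod_const, Finset.card_univ, ← Complex.exp_nat_mul]
    congr 2; push_cast; ring

/-- **Determinant lemma.** If every entry of row `i` of `M(s)` has degree `≤ d i`, then
`det M(s)` has degree `≤ ∑ i, d i` (Leibniz expansion for the degree of the polynomial
determinant, as in Mathlib's `Polynomial.natDegree_det_X_add_C_le`; evaluation through
`RingHom.map_det`). -/
private theorem tp_det {ι : Type*} [Fintype ι] [DecidableEq ι] (d : ι → ℕ)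
    (M : ℝ → Matrix ι ι ℂ) (hM : ∀ i j, ∃ P : ℂ[X], P.natDegree ≤ 2 * d i ∧ ∀ s : ℝ,
      M s i j = exp (-((d i : ℂ) * s * I)) * P.eval (exp (s * I))) :
    ∃ P : ℂ[X], P.natDegree ≤ 2 * ∑ i, d i ∧ ∀ s : ℝ,
      (M s).det = exp (-(((∑ i, d i : ℕ) : ℂ) * s * I)) * P.eval (exp (s * I)) := by
  choose P hP hM using hM
  refine ⟨(Matrix.of P).det, ?_, fun s => ?_⟩
  · rw [Matrix.det_apply']
    refine natDegree_sum_le_of_forall_le _ _ fun σ _ => natDegree_mul_le.trans ?_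
    rw [natDegree_intCast, zero_add]
    refine (natDegree_prod_le _ _).trans ?_
    calc ∑ i, (Matrix.of P (σ i) i).natDegree ≤ ∑ i, 2 * d (σ i) :=
          Finset.sum_le_sum fun i _ => hP _ _
      _ = ∑ i, 2 * d i := Equiv.sum_comp σ (fun i => 2 * d i)
      _ = 2 * ∑ i, d i := (Finset.mul_sum _ _ _).symm
  · have h1 : (Matrix.of P).map (Polynomial.eval (exp (s * I))) =
        Matrix.diagonal (fun i => exp ((d i : ℂ) * s * I)) * M s := by
      ext i j
      rw [Matrix.map_apply, Matrix.of_apply, Matrix.diagonal_mul, hM i j, ← mul_assoc,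
        ← Complex.exp_add, add_neg_cancel, Complex.exp_zero, one_mul]
    have h2 : ((Matrix.of P).det).eval (exp (s * I)) =
        (∏ i, exp ((d i : ℂ) * s * I)) * (M s).det := by
      rw [← Polynomial.coe_evalRingHom, RingHom.map_det, RingHom.mapMatrix_apply,
        Polynomial.coe_evalRingHom, h1, Matrix.det_mul, Matrix.det_diagonal]
    rw [h2, ← mul_assoc, ← Complex.exp_sum, ← Complex.exp_add,
      show -(((∑ i, d i : ℕ) : ℂ) * s * I) + ∑ i, (d i : ℂ) * s * I = 0 by
        rw [Nat.cast_sum, Finset.sum_mul, Finset.sum_mul, neg_add_cancel],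
      Complex.exp_zero, one_mul]

/-- From the Laurent to the Fourier form: `e^{-ins} P(e^{is}) = ∑_{|k| ≤ n} P_{k+n} e^{iks}`. -/
private theorem tp_fourier {n : ℕ} {F : ℝ → ℂ}
    (hF : ∃ P : ℂ[X], P.natDegree ≤ 2 * n ∧ ∀ s : ℝ,
      F s = exp (-((n : ℂ) * s * I)) * P.eval (exp (s * I))) :
    ∃ a : ℤ → ℂ, ∀ s : ℝ,
      F s = ∑ k ∈ Finset.Icc (-(n : ℤ)) (n : ℤ), a k * exp ((k : ℂ) * (s : ℂ) * I) := by
  obtain ⟨P, hP, hF⟩ := hF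
  refine ⟨fun k => P.coeff (k + n).toNat, fun s => ?_⟩
  rw [hF s, eval_eq_sum_range' (Nat.lt_succ_of_le hP), Int.Icc_eq_finset_map, Finset.sum_map,
    Finset.mul_sum, show ((n : ℤ) + 1 - -(n : ℤ)).toNat = 2 * n + 1 by omega]
  refine Finset.sum_congr rfl fun j _ => ?_
  simp only [Function.Embedding.trans_apply, Nat.castEmbedding_apply, addLeftEmbedding_apply]
  rw [show (-(n : ℤ) + j + n).toNat = j by omega, ← Complex.exp_nat_mul, mul_left_comm,
    ← Complex.exp_add]
  congr 2; push_cast; ring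

end TrigPoly

/-! ### The one-link circle inside the Wilson–Dirac matrix -/

section OneLink

open Polynomial Complex

/-- Entries of `A · diag(v(s)) · B` have degree `≤ 1` when the components of `v` do. -/
private theorem tp_conj_diagonal (A B : Matrix (Fin 3) (Fin 3) ℂ) (v : ℝ → Fin 3 → ℂ)
    (hv : ∀ j, ∃ P : ℂ[X], P.natDegree ≤ 2 * 1 ∧ ∀ s : ℝ,
      v s j = exp (-(((1 : ℕ) : ℂ) * s * I)) * P.eval (exp (s * I))) (a b : Fin 3) :
    ∃ P : ℂ[X], P.natDegree ≤ 2 * 1 ∧ ∀ s : ℝ, (A * Matrix.diagonal (v s) * B) a b =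
      exp (-(((1 : ℕ) : ℂ) * s * I)) * P.eval (exp (s * I)) := by
  simp only [Matrix.mul_apply (M := A * Matrix.diagonal _), Matrix.mul_diagonal]
  exact tp_sum _ fun j _ => tp_mul_const (B j b) (tp_smul (A a j) (hv j))

variable (T : ℝ → SU3) (hT : ∀ θ : ℝ, ((T θ : SU3) : Matrix (Fin 3) (Fin 3) ℂ) =
  Matrix.diagonal ![exp (θ * I), exp (-(θ * I)), 1])
  {L : ℕ} (U : GaugeConfig 4 L SU3) (e : Edge 4 L) (A B : SU3)
include hT

/-- The entries of the updated link variable `U_s(x)`: degree `≤ 1` on the moved link `x = e`,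
constant (any degree `n`) off it. -/
private theorem tp_link (x : Edge 4 L) (n : ℕ) (hn : x = e → n = 1) (a b : Fin 3) :
    ∃ P : ℂ[X], P.natDegree ≤ 2 * n ∧ ∀ s : ℝ,
      fundamentalRep (Fin 3) (Function.update U e (A * T s * B) x) a b =
        exp (-((n : ℂ) * s * I)) * P.eval (exp (s * I)) := by
  by_cases hx : x = e
  · obtain rfl := hn hx
    subst hx
    obtain ⟨P, hP, h⟩ := tp_conj_diagonal (A : Matrix (Fin 3) (Fin 3) ℂ) B
      (fun s => ![exp (s * I), exp (-(s * I)), 1])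
      (fun j => by fin_cases j; exacts [tp_exp, tp_exp_neg, tp_const 1 1]) a b
    refine ⟨P, hP, fun s => ?_⟩
    rw [Function.update_self, fundamentalRep_apply, Submonoid.coe_mul, Submonoid.coe_mul, hT]
    exact h s
  · obtain ⟨P, hP, h⟩ := tp_const n (fundamentalRep (Fin 3) (U x) a b)
    exact ⟨P, hP, fun s => by rw [Function.update_of_ne hx]; exact h s⟩

/-- The entries of the inverted updated link variable `U_s(x)⁻¹`: degree `≤ 1` on the moved
link (`(A T(s) B)⁻¹ = B⁻¹ T(s)⁻¹ A⁻¹`, `T(s)⁻¹ = T(s)* = diag(e^{-is}, e^{is}, 1)`), constant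
off it. -/
private theorem tp_link_inv (x : Edge 4 L) (n : ℕ) (hn : x = e → n = 1) (a b : Fin 3) :
    ∃ P : ℂ[X], P.natDegree ≤ 2 * n ∧ ∀ s : ℝ,
      fundamentalRep (Fin 3) (Function.update U e (A * T s * B) x)⁻¹ a b =
        exp (-((n : ℂ) * s * I)) * P.eval (exp (s * I)) := by
  by_cases hx : x = e
  · obtain rfl := hn hx
    subst hx
    have hTinv : ∀ θ : ℝ, (((T θ)⁻¹ : SU3) : Matrix (Fin 3) (Fin 3) ℂ) =
        Matrix.diagonal ![exp (-(θ * I)), exp (θ * I), 1] := by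
      intro θ
      rw [← Matrix.star_eq_inv, Matrix.specialUnitaryGroup.coe_star, hT,
        Matrix.star_eq_conjTranspose, Matrix.diagonal_conjTranspose]
      congr 1
      ext j
      fin_cases j <;> simp [← Complex.exp_conj, Complex.conj_ofReal]
    obtain ⟨P, hP, h⟩ := tp_conj_diagonal ((B⁻¹ : SU3) : Matrix (Fin 3) (Fin 3) ℂ)
      ((A⁻¹ : SU3) : Matrix (Fin 3) (Fin 3) ℂ) (fun s => ![exp (-(s * I)), exp (s * I), 1])
      (fun j => by fin_cases j; exacts [tp_exp_neg, tp_exp, tp_const 1 1]) a b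
    refine ⟨P, hP, fun s => ?_⟩
    rw [Function.update_self, mul_inv_rev, mul_inv_rev, ← mul_assoc, fundamentalRep_apply,
      Submonoid.coe_mul, Submonoid.coe_mul, hTinv]
    exact h s
  · obtain ⟨P, hP, h⟩ := tp_const n (fundamentalRep (Fin 3) (U x)⁻¹ a b)
    exact ⟨P, hP, fun s => by rw [Function.update_of_ne hx]; exact h s⟩

/-- Row-wise degrees of the one-flavour Wilson–Dirac matrix along the circle: the rows through
the two endpoints `e.1`, `e.1 + ê.2` of the moved link have degree `≤ 1` (forward hop through
`U(p.1, μ)`, backward hop through `U(q.1, μ)⁻¹` with `p.1 = q.1 + μ̂`), all other rows are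
constant. -/
private theorem tp_entry (m : ℝ) (p q : TorusSite 4 L × Fin 3 × Fin 4) :
    ∃ P : ℂ[X], P.natDegree ≤ 2 * (if p.1 = e.1 ∨ p.1 = Site.shift e.1 e.2 then 1 else 0) ∧
      ∀ s : ℝ, wilsonDirac (fundamentalRep (Fin 3)) (Function.update U e (A * T s * B)) m 1 p q =
        exp (-(((if p.1 = e.1 ∨ p.1 = Site.shift e.1 e.2 then 1 else 0 : ℕ) : ℂ) * s * I)) *
          P.eval (exp (s * I)) := by
  simp only [wilsonDirac, Matrix.of_apply]
  by_cases hp : p.1 = e.1 ∨ p.1 = Site.shift e.1 e.2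
  · rw [if_pos hp]
    exact tp_sub (tp_const _ _) (tp_smul _ (tp_sum _ fun μ _ => tp_add
      (tp_ite (fun _ => tp_smul _ (tp_link T hT U e A B _ 1 (fun _ => rfl) _ _))
        (fun _ => tp_const _ _))
      (tp_ite (fun _ => tp_smul _ (tp_link_inv T hT U e A B _ 1 (fun _ => rfl) _ _))
        (fun _ => tp_const _ _))))
  · rw [if_neg hp]
    have h1 : ∀ μ : Fin 4, (p.1, μ) ≠ e := fun μ h => hp (Or.inl (by rw [← h]))
    have h2 : ∀ μ : Fin 4, p.1 = Site.shift q.1 μ → (q.1, μ) ≠ e := fun μ hμ h =>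
      hp (Or.inr (by rw [hμ, ← h]))
    exact tp_sub (tp_const _ _) (tp_smul _ (tp_sum _ fun μ _ => tp_add
      (tp_ite (fun _ => tp_smul _ (tp_link T hT U e A B _ 0 (fun h => absurd h (h1 μ)) _ _))
        (fun _ => tp_const _ _))
      (tp_ite (fun hμ => tp_smul _
          (tp_link_inv T hT U e A B _ 0 (fun h => absurd h (h2 μ hμ)) _ _))
        (fun _ => tp_const _ _))))

variable [NeZero L]

/-- One flavour: `det D_W(U_s)` has degree `≤ 24` (determinant lemma with the row degrees of
`tp_entry`; at most `2 · 3 · 4` rows move). -/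
private theorem tp_fermionDet (m : ℝ) : ∃ P : ℂ[X], P.natDegree ≤ 2 * 24 ∧ ∀ s : ℝ,
    fermionDet (wilsonDirac (fundamentalRep (Fin 3)) (Function.update U e (A * T s * B)) m 1) =
      exp (-(((24 : ℕ) : ℂ) * s * I)) * P.eval (exp (s * I)) := by
  have hcard : ∑ p : TorusSite 4 L × Fin 3 × Fin 4,
      (if p.1 = e.1 ∨ p.1 = Site.shift e.1 e.2 then 1 else 0 : ℕ) ≤ 24 := by
    have hoff : ∀ p ∉ ({e.1, Site.shift e.1 e.2} : Finset (TorusSite 4 L)) ×ˢ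
        (Finset.univ : Finset (Fin 3 × Fin 4)),
        (if p.1 = e.1 ∨ p.1 = Site.shift e.1 e.2 then 1 else 0 : ℕ) = 0 := by
      intro p hp
      rw [if_neg]
      exact fun h => hp (Finset.mem_product.mpr
        ⟨by simpa only [Finset.mem_insert, Finset.mem_singleton] using h, Finset.mem_univ _⟩)
    rw [← Finset.sum_subset (Finset.subset_univ _) fun p _ hp => hoff p hp]
    refine (Finset.sum_le_card_nsmul _ _ 1 fun p _ => ?_).trans ?_
    · split <;> omega
    · rw [smul_eq_mul, mul_one, Finset.card_product, Finset.card_univ, Fintype.card_prod,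
        Fintype.card_fin, Fintype.card_fin]
      have := Finset.card_le_two (a := e.1) (b := Site.shift e.1 e.2)
      omega
  exact tp_mono hcard (tp_det _
    (fun s => wilsonDirac (fundamentalRep (Fin 3)) (Function.update U e (A * T s * B)) m 1)
    fun p q => tp_entry T hT U e A B m p q)

end OneLink

/-- STUB 1 (P, size M–L): two-sided band limit of the sea at one link, crude degree `≤ 48 N_f`,
`L ≥ 4`: along `s ↦ A T(s) B` at the link `e`, `|det D(U_s)|² = ∑_{|k| ≤ 48 N_f} a_k e^{iks}`. -/
theorem stub_bandLimit : ∀ T : ℝ → SU3,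
    (∀ θ : ℝ, ((T θ : SU3) : Matrix (Fin 3) (Fin 3) ℂ) =
      Matrix.diagonal ![Complex.exp (θ * Complex.I), Complex.exp (-(θ * Complex.I)), 1]) →
    ∀ (Nf : ℕ) (mq : Fin Nf → ℝ) (L : ℕ) [NeZero L], 4 ≤ L →
    ∀ (U : GaugeConfig 4 L SU3) (e : Edge 4 L) (A B : SU3),
    ∃ a : ℤ → ℂ, ∀ s : ℝ,
      ((‖(diracMatrix (Function.update U e (A * T s * B)) mq).det‖ ^ 2 : ℝ) : ℂ) =
        ∑ k ∈ Finset.Icc (-((48 * Nf : ℕ) : ℤ)) ((48 * Nf : ℕ) : ℤ),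
          a k * Complex.exp ((k : ℂ) * (s : ℂ) * Complex.I) := by
  intro T hT Nf mq L _ _hL U e A B
  have hprod := tp_prod fun f : Fin Nf => tp_fermionDet T hT U e A B (mq f)
  obtain ⟨P, hP, h⟩ := tp_mul hprod hprod
  refine tp_fourier (tp_mono (n := Fintype.card (Fin Nf) * 24 + Fintype.card (Fin Nf) * 24)
    (by simp only [Fintype.card_fin]; omega) ⟨P, hP, fun s => ?_⟩)
  rw [← h s, ← det_diracMatrix, ← Complex.normSq_eq_norm_sq, ← Complex.mul_conj,
    Complex.conj_eq_iff_im.mpr (det_diracMatrix_im _ _)]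

end Summit.QuantumFields.QCD.Theorems.CircleTransport
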